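import Summits.QuantumFields.YangMills.Theorems.UnitScaleTiltFluctuationComparisonRegPrApproxLift
import Literature.MathematicalPhysics.QuantumFieldTheory.Balaban1983to89.T4WilsonGaugeFlatDirection

/-!
# Route `UnitScaleTilt` — crux K1bR-pr `FluctuationComparisonRegPr` (stmt-QuantumFields-19201), stub `stub_oneStepSmallLift`
# (W7 line), step 3b: THE COARSE GAUGE CORRECTION IS FREE in the approximate lift (support file `--supports stmt-QuantumFields-19201`)

Cell `ym3-torus` (rung R3), seat `ym3-torus-p2` gen 8; piece (L3) of the memo HOME/IR-NODE.md §15.  The approximate-lift schema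
`ApproxLift.ApproxLiftStep` asks for `Ū ≈ V` BONDWISE; a construction from the linear certificate naturally gives `Ū ≈ V^h` for a
coarse gauge transformation `h` (the closed first-order averaging defect is a coarse gradient).  By the covariance of the (0.4) averaging
(`BlockAveraging.avgFun_covariant`: `avg (U^u) = (avg U)^{u ∘ emb}`) the blockwise-constant fine gauge transformation `u := h⁻¹ ∘ blockOf`
removes `h` exactly, without changing any plaquette size (`plaqHol_gaugeAct`, `dist1_conj`):

* `approxLiftStep_of_gauge`: `[∀ V δ-small, ∃ U h, PlaqSmall (κ₀δ) U ∧ ∀ c, mdist ((V^h) c) (Ū c) ≤ η] → ApproxLiftStep P j κ₀ η δ`.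

Elementary; nothing of Bałaban's is asserted.
-/

noncomputable section

open NormedSpace Set Metric Function Filter Topology
open scoped RealInnerProductSpace Quaternion NNReal Matrix.Norms.L2Operator

namespace Summit.QuantumFields.YangMills.Theorems.ApproxLift

open Literature.MathematicalPhysics.QuantumFieldTheory.Balaban1983to89
open Literature.MathematicalPhysics.QuantumFieldTheory.Balaban1983to89.T4Continuum
open Literature.MathematicalPhysics.QuantumFieldTheory.Balaban1983to89.AveragingRT
open Literature.MathematicalPhysics.QuantumFieldTheory.Balaban1983to89.BlockAveraging
open Literature.MathematicalPhysics.QuantumFieldTheory.Balaban1983to89.ExpMeanLog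
open Summit.QuantumFields.YangMills.Theorems.MiddleBondRepair

variable {P : Params} {j : ℕ}

/-- A blockwise-constant gauge transformation does not change plaquette sizes. -/
theorem plaqSmall_gaugeAct {δ : ℝ} (u : GaugeTransf P j (Matrix.specialUnitaryGroup (Fin 2) ℂ))
    {U : GaugeField P j (Matrix.specialUnitaryGroup (Fin 2) ℂ)} (hU : PlaqSmall δ U) : PlaqSmall δ (GaugeField.gaugeAct u U) := by
  intro p
  rw [T4WilsonGaugeFlatDirection.plaqHol_gaugeAct, GaugeGroup.dist1_conj]
  exact hU p

/-- The average of a blockwise-constant gauge transform: `avg (U^{h ∘ blockOf}) (c) = h(c₋) · Ū(c) · h(c₊)⁻¹`. -/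
theorem avgFun_gaugeAct_blockOf (hj : j + 1 ≤ P.m + P.K) (h : GaugeTransf P (j + 1) (Matrix.specialUnitaryGroup (Fin 2) ℂ))
    (U : GaugeField P j (Matrix.specialUnitaryGroup (Fin 2) ℂ)) (c : PBond P (j + 1)) :
    avgFun expMeanLogSU (GaugeField.gaugeAct (fun x => h (blockOf x)) U) c = h c.src * avgFun expMeanLogSU U c * (h c.tgt)⁻¹ := by
  rw [avgFun_covariant expMeanLogSU hj]
  show h (blockOf (emb c.src)) * avgFun expMeanLogSU U c * (h (blockOf (emb c.tgt)))⁻¹ = _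
  rw [Site.blockOf_emb hj, Site.blockOf_emb hj]

/-- **THE COARSE GAUGE CORRECTION IS FREE**: an approximate lift of the GAUGE TRANSFORM `V^h` (any coarse gauge transformation `h`) yields an
approximate lift of `V` itself with the same gain and the same accuracy — transform the fine configuration by `h⁻¹ ∘ blockOf`. -/
theorem approxLiftStep_of_gauge (hj : j + 1 ≤ P.m + P.K) {κ₀ η δ : ℝ}
    (h : ∀ V : GaugeField P (j + 1) (Matrix.specialUnitaryGroup (Fin 2) ℂ), PlaqSmall δ V →
      ∃ (U : GaugeField P j (Matrix.specialUnitaryGroup (Fin 2) ℂ)) (g : GaugeTransf P (j + 1) (Matrix.specialUnitaryGroup (Fin 2) ℂ)),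
        PlaqSmall (κ₀ * δ) U ∧ ∀ c, mdist (GaugeField.gaugeAct g V c) (avgFun expMeanLogSU U c) ≤ η) :
    ApproxLiftStep P j κ₀ η δ := by
  intro V hV
  obtain ⟨U, g, hU, hUV⟩ := h V hV
  refine ⟨GaugeField.gaugeAct (fun x => (g (blockOf x))⁻¹) U, plaqSmall_gaugeAct _ hU, fun c => ?_⟩
  rw [avgFun_gaugeAct_blockOf hj (fun y => (g y)⁻¹) U c, inv_inv]
  have hc := hUV c
  rw [← mdist_conj (g c.src)⁻¹ (g c.tgt)] at hc
  have h1 : (g c.src)⁻¹ * GaugeField.gaugeAct g V c * g c.tgt = V c := by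
    show (g c.src)⁻¹ * (g c.src * V c * (g c.tgt)⁻¹) * g c.tgt = V c
    group
  rwa [h1] at hc

end Summit.QuantumFields.YangMills.Theorems.ApproxLift

end
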